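import Summits.CriticalPhenomena.PercolationContinuityZ3.Theses.PercNonSelfAveraging
import Summits.CriticalPhenomena.PercolationContinuityZ3.Theorems.PercNonSelfAveragingLowerTailLadder
import Summits.CriticalPhenomena.PercolationContinuityZ3.Theorems.PercNonSelfAveragingStrictFKGLadder

/-!
# Birth skeleton for piece X1 `ClusterMassAnticoncentration` (child of `ArmMassNSA`, stmt-CriticalPhenomena-7058)

X1: `∃ c > 0, ∀ᶠ n, c · Σ_{x,y ∈ B(n)} P_{p_c}(A_x ∩ {x ↔ y in B(2n)}) ≤ Var(M_n)`, `A_x = {x ↔ ∂⁻B(2n) in B(2n)}`,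
`M_n = Σ_x 1_{A_x}`.  Two stubs (FKG / far-pair line, the analogue for X1 of the route's `StrictFKGLadder`):

* `stub_farPairSlack` — BK SLACK FOR FAR PAIRS: for far pairs `x, y ∈ B(n)` (`∃ i, n ≤ 2|x_i − y_i|`) the
  covariance of the arm events dominates a fixed fraction of the same-cluster probability,
  `c · P(A_x ∩ {x ↔ y}) ≤ P(A_x ∩ A_y) − P(A_x)P(A_y)` (the BK deficit `P(A_x)P(A_y) − P(A_x, A_y, x ↮ y) ≥ 0`
  does not saturate the same-cluster term), eventually in `n`;
* `stub_farPairsCarryMoment` — FAR PAIRS CARRY THE SQUARED CLUSTER MOMENT: a fixed fraction of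
  `E[Q_n] = Σ_{x,y} P(A_x ∩ {x ↔ y})` comes from far pairs (the mass of a spanning cluster inside `B(n)` is not
  concentrated at sub-macroscopic distance from each of its points: a doubling property of the arm-conditioned
  box two-point function), eventually in `n`;

and the PROVED composition `ClusterMassAnticoncentration_of`: `Var(M_n) = Σ_{x,y} Cov(1_{A_x}, 1_{A_y})`
(`variance_sum_indicator_one`), every covariance is `≥ 0` by Harris–FKG (`real_toBdry_mul_le_inter`), so
`Var ≥ Σ_{far} Cov ≥ c₁ Σ_{far} P(A_x ∩ {x↔y}) ≥ c₁ c₂ E[Q_n]`.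
-/

noncomputable section

namespace Summit.CriticalPhenomena.PercolationContinuityZ3.Cruxes.ArmMassNSA.ClusterMassAnticoncentrationBirth

open MeasureTheory ProbabilityTheory Filter
open Literature.Probability.LatticeModels Literature.Probability.Percolation
open Summit.CriticalPhenomena.PercolationContinuityZ3.Theorems
open scoped Classical

/-! ### The two stubs (NOT proved here); `toBdry (2n) x = {x ↔ ∂⁻B(2n) in B(2n)}` is the Literature abbrev,
definitionally the inline event of the route file. -/

/-- STUB 1 — BK slack for far pairs: `c · P(A_x ∩ {x ↔ y in B(2n)}) ≤ Cov(1_{A_x}, 1_{A_y})` for all far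
pairs of `B(n)` (`∃ i, n ≤ 2|x_i − y_i|`), all large `n`. -/
theorem stub_farPairSlack :
    ∃ c : ℝ, 0 < c ∧ ∀ᶠ n : ℕ in atTop, ∀ x ∈ box 3 n, ∀ y ∈ box 3 n, (∃ i : Fin 3, (n : ℤ) ≤ 2 * |x i - y i|) →
      c * (bondPercolation (zdGraph 3) (criticalProbI 3)).real (toBdry (2 * n) x ∩ openConnIn (↑(box 3 (2 * n)) : Set (Site 3)) x y) ≤
        (bondPercolation (zdGraph 3) (criticalProbI 3)).real (toBdry (2 * n) x ∩ toBdry (2 * n) y) -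
          (bondPercolation (zdGraph 3) (criticalProbI 3)).real (toBdry (2 * n) x) * (bondPercolation (zdGraph 3) (criticalProbI 3)).real (toBdry (2 * n) y) := by
  sorry

/-- STUB 2 — far pairs carry a fixed fraction of the squared cluster moment `E[Q_n]`, all large `n`. -/
theorem stub_farPairsCarryMoment :
    ∃ c : ℝ, 0 < c ∧ ∀ᶠ n : ℕ in atTop,
      c * (∑ x ∈ box 3 n, ∑ y ∈ box 3 n, (bondPercolation (zdGraph 3) (criticalProbI 3)).real (toBdry (2 * n) x ∩ openConnIn (↑(box 3 (2 * n)) : Set (Site 3)) x y)) ≤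
        ∑ x ∈ box 3 n, ∑ y ∈ (box 3 n).filter (fun y => (∃ i : Fin 3, (n : ℤ) ≤ 2 * |x i - y i|)),
          (bondPercolation (zdGraph 3) (criticalProbI 3)).real (toBdry (2 * n) x ∩ openConnIn (↑(box 3 (2 * n)) : Set (Site 3)) x y) := by
  sorry

/-! ### The composition (PROVED) -/

/-- The composition in `toBdry` notation. [folklore] -/
theorem anticoncentration_toBdry
    (h1 : ∃ c : ℝ, 0 < c ∧ ∀ᶠ n : ℕ in atTop, ∀ x ∈ box 3 n, ∀ y ∈ box 3 n, (∃ i : Fin 3, (n : ℤ) ≤ 2 * |x i - y i|) →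
      c * (bondPercolation (zdGraph 3) (criticalProbI 3)).real (toBdry (2 * n) x ∩ openConnIn (↑(box 3 (2 * n)) : Set (Site 3)) x y) ≤
        (bondPercolation (zdGraph 3) (criticalProbI 3)).real (toBdry (2 * n) x ∩ toBdry (2 * n) y) -
          (bondPercolation (zdGraph 3) (criticalProbI 3)).real (toBdry (2 * n) x) * (bondPercolation (zdGraph 3) (criticalProbI 3)).real (toBdry (2 * n) y))
    (h2 : ∃ c : ℝ, 0 < c ∧ ∀ᶠ n : ℕ in atTop,
      c * (∑ x ∈ box 3 n, ∑ y ∈ box 3 n, (bondPercolation (zdGraph 3) (criticalProbI 3)).real (toBdry (2 * n) x ∩ openConnIn (↑(box 3 (2 * n)) : Set (Site 3)) x y)) ≤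
        ∑ x ∈ box 3 n, ∑ y ∈ (box 3 n).filter (fun y => (∃ i : Fin 3, (n : ℤ) ≤ 2 * |x i - y i|)),
          (bondPercolation (zdGraph 3) (criticalProbI 3)).real (toBdry (2 * n) x ∩ openConnIn (↑(box 3 (2 * n)) : Set (Site 3)) x y)) :
    ∃ c : ℝ, 0 < c ∧ ∀ᶠ n : ℕ in atTop,
      c * (∑ x ∈ box 3 n, ∑ y ∈ box 3 n, (bondPercolation (zdGraph 3) (criticalProbI 3)).real (toBdry (2 * n) x ∩ openConnIn (↑(box 3 (2 * n)) : Set (Site 3)) x y)) ≤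
        Var[fun ω => ∑ x ∈ box 3 n, (toBdry (2 * n) x).indicator (fun _ => (1 : ℝ)) ω; bondPercolation (zdGraph 3) (criticalProbI 3)] := by
  obtain ⟨c₁, hc₁, h1⟩ := h1
  obtain ⟨c₂, hc₂, h2⟩ := h2
  refine ⟨c₁ * c₂, mul_pos hc₁ hc₂, ?_⟩
  filter_upwards [h1, h2] with n h1n h2n
  have hmeas : ∀ x ∈ box 3 n, MeasurableSet (toBdry (2 * n) x : Set (BondConfig (Site 3))) := fun x _ =>
    measurableSet_toBdry _ x
  rw [variance_sum_indicator_one (bondPercolation (zdGraph 3) (criticalProbI 3)) (box 3 n) _ hmeas]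
  -- every covariance is nonnegative (Harris–FKG)
  have hcov0 : ∀ x y : Site 3, 0 ≤ (bondPercolation (zdGraph 3) (criticalProbI 3)).real (toBdry (2 * n) x ∩ toBdry (2 * n) y) -
      (bondPercolation (zdGraph 3) (criticalProbI 3)).real (toBdry (2 * n) x) * (bondPercolation (zdGraph 3) (criticalProbI 3)).real (toBdry (2 * n) y) := fun x y =>
    sub_nonneg.2 (real_toBdry_mul_le_inter (criticalProbI 3) (2 * n) x y)
  -- drop the near pairs
  have hdrop : ∑ x ∈ box 3 n, ∑ y ∈ (box 3 n).filter (fun y => (∃ i : Fin 3, (n : ℤ) ≤ 2 * |x i - y i|)),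
      ((bondPercolation (zdGraph 3) (criticalProbI 3)).real (toBdry (2 * n) x ∩ toBdry (2 * n) y) - (bondPercolation (zdGraph 3) (criticalProbI 3)).real (toBdry (2 * n) x) * (bondPercolation (zdGraph 3) (criticalProbI 3)).real (toBdry (2 * n) y)) ≤
      ∑ x ∈ box 3 n, ∑ y ∈ box 3 n,
        ((bondPercolation (zdGraph 3) (criticalProbI 3)).real (toBdry (2 * n) x ∩ toBdry (2 * n) y) - (bondPercolation (zdGraph 3) (criticalProbI 3)).real (toBdry (2 * n) x) * (bondPercolation (zdGraph 3) (criticalProbI 3)).real (toBdry (2 * n) y)) :=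
    Finset.sum_le_sum fun x _ =>
      Finset.sum_le_sum_of_subset_of_nonneg (Finset.filter_subset _ _) fun y _ _ => hcov0 x y
  -- far pairs: stub 1 termwise
  have hfar : ∑ x ∈ box 3 n, ∑ y ∈ (box 3 n).filter (fun y => (∃ i : Fin 3, (n : ℤ) ≤ 2 * |x i - y i|)),
      c₁ * (bondPercolation (zdGraph 3) (criticalProbI 3)).real (toBdry (2 * n) x ∩ openConnIn (↑(box 3 (2 * n)) : Set (Site 3)) x y) ≤
      ∑ x ∈ box 3 n, ∑ y ∈ (box 3 n).filter (fun y => (∃ i : Fin 3, (n : ℤ) ≤ 2 * |x i - y i|)),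
        ((bondPercolation (zdGraph 3) (criticalProbI 3)).real (toBdry (2 * n) x ∩ toBdry (2 * n) y) - (bondPercolation (zdGraph 3) (criticalProbI 3)).real (toBdry (2 * n) x) * (bondPercolation (zdGraph 3) (criticalProbI 3)).real (toBdry (2 * n) y)) :=
    Finset.sum_le_sum fun x hx => Finset.sum_le_sum fun y hy =>
      h1n x hx y (Finset.mem_filter.1 hy).1 (Finset.mem_filter.1 hy).2
  -- stub 2 and bookkeeping
  have hsum_mul : ∑ x ∈ box 3 n, ∑ y ∈ (box 3 n).filter (fun y => (∃ i : Fin 3, (n : ℤ) ≤ 2 * |x i - y i|)),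
      c₁ * (bondPercolation (zdGraph 3) (criticalProbI 3)).real (toBdry (2 * n) x ∩ openConnIn (↑(box 3 (2 * n)) : Set (Site 3)) x y) =
      c₁ * ∑ x ∈ box 3 n, ∑ y ∈ (box 3 n).filter (fun y => (∃ i : Fin 3, (n : ℤ) ≤ 2 * |x i - y i|)),
        (bondPercolation (zdGraph 3) (criticalProbI 3)).real (toBdry (2 * n) x ∩ openConnIn (↑(box 3 (2 * n)) : Set (Site 3)) x y) := by
    rw [Finset.mul_sum]
    refine Finset.sum_congr rfl fun x _ => ?_
    rw [Finset.mul_sum]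
  have h2' : c₁ * (c₂ * ∑ x ∈ box 3 n, ∑ y ∈ box 3 n, (bondPercolation (zdGraph 3) (criticalProbI 3)).real (toBdry (2 * n) x ∩ openConnIn (↑(box 3 (2 * n)) : Set (Site 3)) x y)) ≤
      c₁ * ∑ x ∈ box 3 n, ∑ y ∈ (box 3 n).filter (fun y => (∃ i : Fin 3, (n : ℤ) ≤ 2 * |x i - y i|)),
        (bondPercolation (zdGraph 3) (criticalProbI 3)).real (toBdry (2 * n) x ∩ openConnIn (↑(box 3 (2 * n)) : Set (Site 3)) x y) :=
    mul_le_mul_of_nonneg_left h2n hc₁.le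
  calc c₁ * c₂ * ∑ x ∈ box 3 n, ∑ y ∈ box 3 n, (bondPercolation (zdGraph 3) (criticalProbI 3)).real (toBdry (2 * n) x ∩ openConnIn (↑(box 3 (2 * n)) : Set (Site 3)) x y)
      = c₁ * (c₂ * ∑ x ∈ box 3 n, ∑ y ∈ box 3 n, (bondPercolation (zdGraph 3) (criticalProbI 3)).real (toBdry (2 * n) x ∩ openConnIn (↑(box 3 (2 * n)) : Set (Site 3)) x y)) := by ring
    _ ≤ _ := h2'
    _ = _ := hsum_mul.symm
    _ ≤ _ := hfar
    _ ≤ _ := hdrop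

/-- **`ClusterMassAnticoncentration` from the two stubs** (conclusion = the statement of stmt-CriticalPhenomena-18189
verbatim; a prover closing the item wraps it by name). [folklore] -/
theorem ClusterMassAnticoncentration_of
    (h1 : ∃ c : ℝ, 0 < c ∧ ∀ᶠ n : ℕ in atTop, ∀ x ∈ box 3 n, ∀ y ∈ box 3 n, (∃ i : Fin 3, (n : ℤ) ≤ 2 * |x i - y i|) →
      c * (bondPercolation (zdGraph 3) (criticalProbI 3)).real (toBdry (2 * n) x ∩ openConnIn (↑(box 3 (2 * n)) : Set (Site 3)) x y) ≤
        (bondPercolation (zdGraph 3) (criticalProbI 3)).real (toBdry (2 * n) x ∩ toBdry (2 * n) y) -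
          (bondPercolation (zdGraph 3) (criticalProbI 3)).real (toBdry (2 * n) x) * (bondPercolation (zdGraph 3) (criticalProbI 3)).real (toBdry (2 * n) y))
    (h2 : ∃ c : ℝ, 0 < c ∧ ∀ᶠ n : ℕ in atTop,
      c * (∑ x ∈ box 3 n, ∑ y ∈ box 3 n, (bondPercolation (zdGraph 3) (criticalProbI 3)).real (toBdry (2 * n) x ∩ openConnIn (↑(box 3 (2 * n)) : Set (Site 3)) x y)) ≤
        ∑ x ∈ box 3 n, ∑ y ∈ (box 3 n).filter (fun y => (∃ i : Fin 3, (n : ℤ) ≤ 2 * |x i - y i|)),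
          (bondPercolation (zdGraph 3) (criticalProbI 3)).real (toBdry (2 * n) x ∩ openConnIn (↑(box 3 (2 * n)) : Set (Site 3)) x y)) :
    ∃ c : ℝ, 0 < c ∧ ∀ᶠ n : ℕ in Filter.atTop, c * (∑ x ∈ Literature.Probability.LatticeModels.box 3 n, ∑ y ∈ Literature.Probability.LatticeModels.box 3 n, (Literature.Probability.Percolation.bondPercolation (Literature.Probability.LatticeModels.zdGraph 3) (Literature.Probability.Percolation.criticalProbI 3)).real ({ω | ∃ z ∈ Literature.Probability.LatticeModels.innerBoundary (Literature.Probability.LatticeModels.zdGraph 3) (Literature.Probability.LatticeModels.box 3 (2 * n)), ω ∈ Literature.Probability.Percolation.openConnIn ↑(Literature.Probability.LatticeModels.box 3 (2 * n)) x z} ∩ Literature.Probability.Percolation.openConnIn ↑(Literature.Probability.LatticeModels.box 3 (2 * n)) x y)) ≤ ProbabilityTheory.variance (fun ω => ∑ x ∈ Literature.Probability.LatticeModels.box 3 n, Set.indicator {ω' | ∃ y ∈ Literature.Probability.LatticeModels.innerBoundary (Literature.Probability.LatticeModels.zdGraph 3) (Literature.Probability.LatticeModels.box 3 (2 * n)),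 ω' ∈ Literature.Probability.Percolation.openConnIn ↑(Literature.Probability.LatticeModels.box 3 (2 * n)) x y} (fun _ => (1 : ℝ)) ω) (Literature.Probability.Percolation.bondPercolation (Literature.Probability.LatticeModels.zdGraph 3) (Literature.Probability.Percolation.criticalProbI 3)) :=
  -- the conclusion is character-for-character the statement of item stmt-CriticalPhenomena-18189
  -- (`PercNonSelfAveraging.ClusterMassAnticoncentration`, route file rev ≥ 3); `toBdry` is definitionally
  -- the inline arm event, so the `toBdry`-form composition closes it by `exact`.
  anticoncentration_toBdry h1 h2

/-- The piece from its stubs (kernel-checked composition; sorries only in `stub_*`). -/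
theorem ClusterMassAnticoncentration_of_stubs :
    ∃ c : ℝ, 0 < c ∧ ∀ᶠ n : ℕ in Filter.atTop, c * (∑ x ∈ Literature.Probability.LatticeModels.box 3 n, ∑ y ∈ Literature.Probability.LatticeModels.box 3 n, (Literature.Probability.Percolation.bondPercolation (Literature.Probability.LatticeModels.zdGraph 3) (Literature.Probability.Percolation.criticalProbI 3)).real ({ω | ∃ z ∈ Literature.Probability.LatticeModels.innerBoundary (Literature.Probability.LatticeModels.zdGraph 3) (Literature.Probability.LatticeModels.box 3 (2 * n)), ω ∈ Literature.Probability.Percolation.openConnIn ↑(Literature.Probability.LatticeModels.box 3 (2 * n)) x z} ∩ Literature.Probability.Percolation.openConnIn ↑(Literature.Probability.LatticeModels.box 3 (2 * n)) x y)) ≤ ProbabilityTheory.variance (fun ω => ∑ x ∈ Literature.Probability.LatticeModels.box 3 n, Set.indicator {ω' | ∃ y ∈ Literature.Probability.LatticeModels.innerBoundary (Literature.Probability.LatticeModels.zdGraph 3) (Literature.Probability.LatticeModels.box 3 (2 * n)), ω' ∈ Literature.Probability.Percolation.openConnIn ↑(Literature.Probability.LatticeModels.box 3 (2 * n)) x y}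 (fun _ => (1 : ℝ)) ω) (Literature.Probability.Percolation.bondPercolation (Literature.Probability.LatticeModels.zdGraph 3) (Literature.Probability.Percolation.criticalProbI 3)) :=
  ClusterMassAnticoncentration_of stub_farPairSlack stub_farPairsCarryMoment

end Summit.CriticalPhenomena.PercolationContinuityZ3.Cruxes.ArmMassNSA.ClusterMassAnticoncentrationBirth

end
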